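import Mathlib
import Summits.ValiantsHypothesis.ValiantsHypothesis.Theorems.FifoMatchingNNNotVPSupportFnCircuitLowerBound
import Literature.Computability.Complexity.CircuitLP
import Literature.Barriers.PneNP.MonotoneGapProofs
import Literature.Computability.AlgebraicComplexity.ArithCircuitProofs
import HarnessLib

/-!
# Route FifoMatching — crux `NNNotVP` (stmt-ValiantsHypothesis-11615), line `division_split`:
# stub A ⟺ a lower bound on `circuitSizeOver monotoneBasis` (the converse direction)

Registered line `Cruxes/NNNotVP/Lines/division_split.lean`; objects `σ` / `NN` / `SuppFn` /
`freeVars` = the line's vocabulary (`Theorems/FifoMatchingNNNotVPDivisionSplitDefs.lean`).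

The companions proved: a super-quasi-polynomial lower bound on `circuitSizeOver monotoneBasis` of
nest-free perfect-matching existence ⇒ the core of stub A ⇒ stub A.  This file closes the loop:

* `exists_poly_of_monotoneCircuit` — **the arithmetic lift of a monotone Boolean circuit**: a
  circuit over `{∧₂, ∨₂}` with `s` gates computing `F` yields a nonnegative polynomial `g` with
  `L₊(g) ≤ s` whose support function is `F` (`∨ ↦ +`, `∧ ↦ ×`; over `ℝ≥0` a sum is nonzero iff a
  summand is, a product iff both factors are);
* `monotoneCircuit_lowerBound_of_core`, `circuitSizeOver_lowerBound_of_core` — the core of stub A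
  ⇒ every `{∧₂, ∨₂}`-circuit for nest-free perfect-matching existence is super-quasi-polynomial
  (for `circuitSizeOver`, such circuits exist: `Literature.Barriers.PneNP.exists_monotone_circuit`);
* `core_iff_circuitSizeOver_lowerBound`, `supportFnHard_iff_circuitSizeOver_lowerBound` —
  **stub A (`stub_supportFnHard`, verbatim) ⟺ «for all `c`, eventually
  `2^((log₂ n + c)^c) < circuitSizeOver monotoneBasis (NFPM-existence on the arcs of [2n])`»**.

Honest framing: an equivalence of OPEN statements (a faithful restatement of stub A in the tree's
Boolean-circuit vocabulary); stubs Z / A / B2, the crux `NNNotVP` and `VP ≠ VNP` stay OPEN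
(NOT proved).  No definitions, no named facts.
-/

noncomputable section

-- Sub = Summit single-conjunct layout: the duplicated namespace component is mandated by the tree.
set_option linter.dupNamespace false

namespace Summit.ValiantsHypothesis.ValiantsHypothesis.Theorems.FifoMatching.NNNotVP.DivisionSplit

open MvPolynomial Literature.Computability.AlgebraicComplexity
open Literature.Computability.Complexity
open Literature.Computability.Complexity.GateList
open scoped NNReal BigOperators Classical

variable {τ : Type*}

/-! ### The arithmetic lift of a monotone Boolean circuit -/

/-- **The arithmetic lift.**  A circuit over `monotoneBasis` with `s` gates yields `g ∈ ℝ≥0[x_τ]`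
with `L₊(g) ≤ s` and `[g(1_x) ≠ 0] = C(x)` for all `x`. [folklore] -/
theorem exists_poly_of_monotoneCircuit (C : Circuit τ) (hC : C.IsOver monotoneBasis) :
    ∃ g : MvPolynomial τ ℝ≥0, complexity g ≤ C.size ∧
      ∀ x : τ → Bool, decide (eval (fun v => if x v then (1 : ℝ≥0) else 0) g ≠ 0) = C.eval x := by
  -- the Boolean shadow of a polynomial at the 0/1 point of `x`
  let b : (τ → Bool) → MvPolynomial τ ℝ≥0 → Bool :=
    fun x p => decide (eval (fun v => if x v then (1 : ℝ≥0) else 0) p ≠ 0)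
  -- wires and gates
  let toOp : τ ⊕ ℕ → ArithCircuit.Operand ℝ≥0 τ := fun w =>
    match w with
    | .inl i => .var i
    | .inr m => .gate m
  let trG : Gate τ → ArithCircuit.Gate ℝ≥0 τ := fun G =>
    if G.fn = GateFn.and 2 then .prod ((List.ofFn G.args).map toOp)
    else .sum ((List.ofFn G.args).map fun a => (1, toOp a))
  have hb0 : ∀ x, b x 0 = false := fun x => by simp [b]
  -- wire semantics
  have hop : ∀ (x : τ → Bool) (W : List (MvPolynomial τ ℝ≥0)) (w : τ ⊕ ℕ),
      wireOf x (W.map (b x)) w = b x ((toOp w).eval W) := by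
    intro x W w
    rcases w with i | m
    · simp only [toOp, wireOf_inl, ArithCircuit.Operand.eval, b, eval_X]
      cases x i <;> simp
    · simp only [toOp, wireOf_inr, ArithCircuit.Operand.eval_gate]
      rw [← hb0 x, List.getD_map]
  -- gate semantics and fan-in, for gates of the monotone basis
  have hgate : ∀ G : Gate τ, G.fn ∈ monotoneBasis →
      (trG G).fanIn ≤ 2 ∧ ∀ (x : τ → Bool) (W : List (MvPolynomial τ ℝ≥0)),
        G.op (fun a => wireOf x (W.map (b x)) (G.args a)) = b x ((trG G).eval W) := by
    rintro ⟨ar, op, args⟩ hG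
    simp only [monotoneBasis, Set.mem_insert_iff, Set.mem_singleton_iff, Gate.fn] at hG
    rcases hG with h | h
    · -- an AND gate
      have har : ar = 2 := congrArg Sigma.fst h
      subst har
      have hop2 : op = fun v : Fin 2 → Bool => decide (∀ i, v i = true) :=
        eq_of_heq (Sigma.mk.inj_iff.1 h).2
      subst hop2
      have htr : trG ⟨2, (fun v : Fin 2 → Bool => decide (∀ i, v i = true)), args⟩ =
          .prod [toOp (args 0), toOp (args 1)] := by
        simp only [trG, Gate.fn]
        rw [if_pos h]
        simp [List.ofFn_succ]
      rw [htr]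
      refine ⟨by simp [ArithCircuit.Gate.fanIn, ArithCircuit.Gate.args], fun x W => ?_⟩
      have e : (⟨2, (fun v : Fin 2 → Bool => decide (∀ i, v i = true)), args⟩ : Gate τ).op
            (fun a => wireOf x (W.map (b x)) (args a)) =
          (wireOf x (W.map (b x)) (args 0) && wireOf x (W.map (b x)) (args 1)) := by
        show decide (∀ i : Fin 2, wireOf x (W.map (b x)) (args i) = true) = _
        rw [Bool.eq_iff_iff, decide_eq_true_iff, Bool.and_eq_true, Fin.forall_fin_two]
      rw [e, hop x W (args 0), hop x W (args 1)]
      simp only [ArithCircuit.Gate.eval, List.map_cons, List.map_nil, List.prod_cons,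
        List.prod_nil, mul_one, b, map_mul, decide_mul_ne_zero]
    · -- an OR gate
      have har : ar = 2 := congrArg Sigma.fst h
      subst har
      have hop2 : op = fun v : Fin 2 → Bool => decide (∃ i, v i = true) :=
        eq_of_heq (Sigma.mk.inj_iff.1 h).2
      subst hop2
      have hne : (⟨2, (fun v : Fin 2 → Bool => decide (∃ i, v i = true))⟩ : GateFn) ≠ GateFn.and 2 :=
        fun h' => gateFn_and_two_ne_or_two (h'.symm.trans h)
      have htr : trG ⟨2, (fun v : Fin 2 → Bool => decide (∃ i, v i = true)), args⟩ =
          .sum [(1, toOp (args 0)), (1, toOp (args 1))] := by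
        simp only [trG, Gate.fn]
        rw [if_neg hne]
        simp [List.ofFn_succ]
      rw [htr]
      refine ⟨by simp [ArithCircuit.Gate.fanIn, ArithCircuit.Gate.args], fun x W => ?_⟩
      have e : (⟨2, (fun v : Fin 2 → Bool => decide (∃ i, v i = true)), args⟩ : Gate τ).op
            (fun a => wireOf x (W.map (b x)) (args a)) =
          (wireOf x (W.map (b x)) (args 0) || wireOf x (W.map (b x)) (args 1)) := by
        show decide (∃ i : Fin 2, wireOf x (W.map (b x)) (args i) = true) = _
        rw [Bool.eq_iff_iff, decide_eq_true_iff, Bool.or_eq_true, Fin.exists_fin_two]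
      rw [e, hop x W (args 0), hop x W (args 1)]
      simp only [ArithCircuit.Gate.eval, List.map_cons, List.map_nil, List.sum_cons,
        List.sum_nil, add_zero, one_smul, b, map_add, decide_add_ne_zero]
  -- the lifted program, by induction along the Boolean circuit
  have key : ∀ gs : List (Gate τ), (∀ G ∈ gs, G.fn ∈ monotoneBasis) →
      ∀ x, vals gs x = (ArithCircuit.gateValues (gs.map trG)).map (b x) := by
    intro gs
    induction gs using List.reverseRecOn with
    | nil => intro _ x; simp [ArithCircuit.gateValues]
    | append_singleton gs G ih =>
      intro hgs x
      have hG : G.fn ∈ monotoneBasis := hgs G (List.mem_append_right _ (List.mem_singleton_self G))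
      rw [vals_append_singleton, ih (fun G' hG' => hgs G' (List.mem_append_left _ hG')) x,
        List.map_append, List.map_singleton, ArithCircuit.gateValues_append_singleton,
        List.map_append, List.map_singleton, (hgate G hG).2 x]
  -- the arithmetic circuit
  let P : ArithCircuit ℝ≥0 τ := ⟨C.gates.map trG, toOp C.output⟩
  have hfan : P.IsFanInTwo := by
    intro G hG
    obtain ⟨G', hG', rfl⟩ := List.mem_map.1 hG
    exact (hgate G' (hC G' hG')).1
  refine ⟨P.eval, ?_, fun x => ?_⟩
  · calc complexity P.eval ≤ P.size := ArithCircuit.complexity_le_size hfan rfl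
      _ = C.size := by simp [P, ArithCircuit.size, Circuit.size]
  · have hev : C.eval x = wireOf x (vals C.gates x) C.output := by
      rw [← circuit_wireVals]
      unfold Circuit.eval
      rcases C.output with i | m <;> rfl
    rw [hev, key C.gates hC x, hop x]
    rfl

/-! ### The core of stub A implies the monotone Boolean lower bound -/

/-- **The core of stub A ⇒ every `{∧₂, ∨₂}`-circuit for nest-free perfect-matching existence is
super-quasi-polynomial** (its arithmetic lift has the support function of `NN_n`). [folklore] -/
theorem monotoneCircuit_lowerBound_of_core
    (hA₀ : ∀ c : ℕ, ∃ n₀ : ℕ, ∀ n ≥ n₀, ∀ g : MvPolynomial (σ n) ℝ≥0,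
      (∀ A : Finset (σ n), SuppFn g A ↔ SuppFn (NN n) A) →
        2 ^ ((Nat.log 2 n + c) ^ c) < complexity g) :
    ∀ c : ℕ, ∃ n₀ : ℕ, ∀ n ≥ n₀, ∀ C : Circuit (σ n), C.IsOver monotoneBasis →
      C.Computes (fun x : σ n → Bool =>
        decide (SuppFn (NN n) (Finset.univ.filter fun e => x e = true))) →
        2 ^ ((Nat.log 2 n + c) ^ c) < C.size := by
  intro c
  obtain ⟨n₀, hn₀⟩ := hA₀ c
  refine ⟨n₀, fun n hn C hC hF => ?_⟩
  obtain ⟨g, hgs, hg⟩ := exists_poly_of_monotoneCircuit C hC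
  have hsupp : ∀ A : Finset (σ n), SuppFn g A ↔ SuppFn (NN n) A := by
    intro A
    -- read both support functions off the indicator vector of `A`
    have h1 := hg (fun e => decide (e ∈ A))
    rw [hF] at h1
    dsimp only at h1
    have h2 : (Finset.univ.filter fun e : σ n => decide (e ∈ A) = true) = A := by
      ext e; simp
    rw [h2] at h1
    rw [suppFn_iff_eval_ne_zero g A]
    have h3 := decide_eq_decide.1 h1
    have h4 : (fun v : σ n => if decide (v ∈ A) then (1 : ℝ≥0) else 0) =
        fun v => if v ∈ A then (1 : ℝ≥0) else 0 := by
      funext v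
      by_cases hv : v ∈ A
      · rw [if_pos hv, if_pos (decide_eq_true hv)]
      · rw [if_neg hv, if_neg (by simpa using hv)]
    rw [h4] at h3
    convert h3 using 8
  exact lt_of_lt_of_le (hn₀ n hn g hsupp) hgs

/-- **The core of stub A ⇒ a lower bound on `circuitSizeOver monotoneBasis`** of nest-free
perfect-matching existence (a monotone, non-constant function for `n ≥ 1`, so the infimum is
attained: `Literature.Barriers.PneNP.exists_monotone_circuit`). [folklore] -/
theorem circuitSizeOver_lowerBound_of_core
    (hA₀ : ∀ c : ℕ, ∃ n₀ : ℕ, ∀ n ≥ n₀, ∀ g : MvPolynomial (σ n) ℝ≥0,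
      (∀ A : Finset (σ n), SuppFn g A ↔ SuppFn (NN n) A) →
        2 ^ ((Nat.log 2 n + c) ^ c) < complexity g) :
    ∀ c : ℕ, ∃ n₀ : ℕ, ∀ n ≥ n₀, 2 ^ ((Nat.log 2 n + c) ^ c) <
      circuitSizeOver monotoneBasis
        (fun x : σ n → Bool => decide (SuppFn (NN n) (Finset.univ.filter fun e => x e = true))) := by
  intro c
  obtain ⟨n₀, hn₀⟩ := monotoneCircuit_lowerBound_of_core hA₀ c
  refine ⟨max n₀ 1, fun n hn => ?_⟩
  have hn0 : n₀ ≤ n := le_trans (le_max_left _ _) hn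
  have hn1 : 1 ≤ n := le_trans (le_max_right _ _) hn
  -- the function is monotone and non-constant: a monotone circuit exists
  obtain ⟨hU, hE⟩ := suppFn_NN_univ_and_empty n hn1
  have hmono : Monotone (fun x : σ n → Bool =>
      decide (SuppFn (NN n) (Finset.univ.filter fun e => x e = true))) := by
    intro x y hxy
    apply Bool.le_iff_imp.2
    intro hx
    rw [decide_eq_true_iff] at hx ⊢
    refine SuppFn.mono (fun e he => ?_) hx
    rw [Finset.mem_filter] at he ⊢
    exact ⟨he.1, Bool.eq_true_of_true_le (he.2 ▸ hxy e)⟩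
  have h0 : (fun x : σ n → Bool =>
      decide (SuppFn (NN n) (Finset.univ.filter fun e => x e = true))) (fun _ => false) = false := by
    have hf : (Finset.univ.filter fun _ : σ n => false = true) = ∅ :=
      Finset.filter_eq_empty_iff.2 (by simp)
    show decide (SuppFn (NN n) (Finset.univ.filter fun _ : σ n => false = true)) = false
    rw [hf]
    exact decide_eq_false hE
  have h1 : (fun x : σ n → Bool =>
      decide (SuppFn (NN n) (Finset.univ.filter fun e => x e = true))) (fun _ => true) = true := by
    have ht : (Finset.univ.filter fun _ : σ n => true = true) = Finset.univ :=
      Finset.filter_true_of_mem (fun _ _ => rfl)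
    show decide (SuppFn (NN n) (Finset.univ.filter fun _ : σ n => true = true)) = true
    rw [ht]
    exact decide_eq_true hU
  obtain ⟨C₀, hC₀, hF₀⟩ := Literature.Barriers.PneNP.exists_monotone_circuit _ hmono h0 h1
  -- the infimum is attained
  have hne : {s | ∃ C : Circuit (σ n), C.IsOver monotoneBasis ∧
      C.Computes (fun x : σ n → Bool =>
        decide (SuppFn (NN n) (Finset.univ.filter fun e => x e = true))) ∧ C.size = s}.Nonempty :=
    ⟨C₀.size, C₀, hC₀, hF₀, rfl⟩
  obtain ⟨C, hC, hF, hsize⟩ := Nat.sInf_mem hne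
  unfold circuitSizeOver
  rw [← hsize]
  exact hn₀ n hn0 C hC hF

/-- **The core of stub A ⟺ the `circuitSizeOver monotoneBasis` lower bound.** [folklore] -/
theorem core_iff_circuitSizeOver_lowerBound :
    (∀ c : ℕ, ∃ n₀ : ℕ, ∀ n ≥ n₀, ∀ g : MvPolynomial (σ n) ℝ≥0,
      (∀ A : Finset (σ n), SuppFn g A ↔ SuppFn (NN n) A) →
        2 ^ ((Nat.log 2 n + c) ^ c) < complexity g) ↔
    (∀ c : ℕ, ∃ n₀ : ℕ, ∀ n ≥ n₀, 2 ^ ((Nat.log 2 n + c) ^ c) <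
      circuitSizeOver monotoneBasis
        (fun x : σ n → Bool => decide (SuppFn (NN n) (Finset.univ.filter fun e => x e = true)))) :=
  ⟨circuitSizeOver_lowerBound_of_core, core_of_circuitSizeOver_lowerBound⟩

/-- **Stub A (`stub_supportFnHard`, verbatim) ⟺ the `circuitSizeOver monotoneBasis` lower bound
for nest-free perfect-matching existence** — the registered stub restated faithfully in the tree's
Boolean-circuit vocabulary (`supportFnHard_iff_core` ∘ `core_iff_circuitSizeOver_lowerBound`).
Both sides are OPEN. [folklore] -/
theorem supportFnHard_iff_circuitSizeOver_lowerBound :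
    (∀ k c : ℕ, ∃ n₀ : ℕ, ∀ n ≥ n₀, ∀ T : Finset (σ n), T.card ≤ (Nat.log 2 n + k) ^ k →
      ∀ g : MvPolynomial (σ n) ℝ≥0, (∀ A : Finset (σ n), SuppFn g A ↔ SuppFn (freeVars T (NN n)) A) →
        2 ^ ((Nat.log 2 n + c) ^ c) < complexity g) ↔
    (∀ c : ℕ, ∃ n₀ : ℕ, ∀ n ≥ n₀, 2 ^ ((Nat.log 2 n + c) ^ c) <
      circuitSizeOver monotoneBasis
        (fun x : σ n → Bool => decide (SuppFn (NN n) (Finset.univ.filter fun e => x e = true)))) :=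
  supportFnHard_iff_core.trans core_iff_circuitSizeOver_lowerBound

end Summit.ValiantsHypothesis.ValiantsHypothesis.Theorems.FifoMatching.NNNotVP.DivisionSplit

end
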